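import Literature.NumberTheory.Transcendental.ZilberFieldGSGC
import Literature.NumberTheory.Transcendental.LocusComponents
import Literature.RingTheory.KrullDimension.FibreDimension
import HarnessLib

/-!
# Dimension of the fibres of a monomial map on the torus part of a `k`-variety

Standard algebraic geometry — the theorem on the dimension of the fibres of a dominant morphism
(Springer, *Linear Algebraic Groups*, Thm 5.1.6 (ii); Mumford, *Red Book*, I §8 Thms 2–3;
Hartshorne II Ex. 3.22) — in the concrete affine form used in Bays–Kirby's proof of Prop. 11.5
of *Pseudo-exponential maps, variants, and quasiminimality* (ANT 12 (2018)): "By the fibre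
dimension theorem, there is a proper Zariski-closed subset `W_H` of `W`, defined over `K`,
containing all the fibres of `θ_H` of atypical dimension." For a prime `P ⊆ k[X, Y]` (`k ⊆ F`
fields, `F` algebraically closed, both blocks of variables indexed by `Fin N`), the `F`-variety
`W = Z_F(P)` with torus part `W ∩ Gᴺ` (`Gᴺ = 𝔾ₐᴺ × 𝔾ₘᴺ`,
`Literature.NumberTheory.Transcendental.torusLocus`) and the monomial map `[M]` of an integer
matrix (`Literature.NumberTheory.Transcendental.matrixAct`), we prove
`MonomialFibre.exists_fibre_dimension_bound`: there is a polynomial `h` over `k`, not vanishing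
identically on `[M](W ∩ Gᴺ)`, such that for every torus point `z` of `W` whose value `y = [M] z`
is `k`-rational with `h(y) ≠ 0`,

  `dim_F {w ∈ W ∩ Gᴺ | [M] w = y} + dim_F [M](W ∩ Gᴺ) ≤ dim k[X, Y] ⧸ P`.

Hence the torus points of `W` with `k`-rational image lying in a fibre of `[M]` of dimension
larger than `dim W - dim [M] W` all lie in the proper `k`-closed subset `{h ∘ [M] = 0}` of `W`.

## Proof

The coordinate ring over `k` of `W ∩ Gᴺ` is `A = k[W][1/ȳ]` (`k[W] = k[X, Y] ⧸ P`, `ȳ = ∏ Yᵢ`;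
`MonomialFibre.CoordG`), and `[M]` corresponds to the subalgebra `B = k[θ] ⊆ A` generated by the
coordinates `θ = [M] ξ` of the image of the generic point (`MonomialFibre.thetaAlg`). The generic
equidimensionality of the fibres of `Spec A → Spec B`
(`Literature.RingTheory.KrullDimension.exists_ringKrullDim_quotient_eq_of_mem_minimalPrimes`:
some `f ≠ 0` in `B` such that for every maximal `m ∌ f` every minimal prime of `m A` has quotient
of dimension `r = dim A - dim B`) is applied at the maximal ideal `m_y ⊆ B` of the rational value
`y` (`MonomialFibre.maxIdeal`, the kernel of evaluation `B → k`). The `k`-closure of the `F`-fibre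
over `y` is cut out by an ideal containing the contraction `𝔞` of `m_y A` to `k[X, Y]` (every
`F`-point of the fibre kills `m_y A`, `MonomialFibre.ev_eq_zero_of_mem_map_maxIdeal`), and
`dim k[W] ⧸ 𝔞 ≤ r` because the minimal primes of a contracted ideal avoid `ȳ`
(`MonomialFibre.prodY_notMem_of_mem_minimalPrimes_comap`) and extend to minimal primes of `m_y A`
with the same quotient dimension (prime correspondence for localisations; localising an affine
domain does not change the dimension). Dimensions over `F` are bounded by dimensions of
`k`-closures (`Literature.RingTheory.KrullDimension.ringKrullDim_quotient_vanishingIdeal_le`);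
`dim_F [M](W ∩ Gᴺ) ≤ dim B` and `dim A = dim k[W]`. The witness `h([M] w) ≠ 0` comes from a
component of `W_F` (`LocusComponents`) and the fraction field of `A`.

Auxiliary result of independent use: `ringKrullDim_quotient_le_of_minimalPrimes` (`dim R ⧸ I ≤ n`
as soon as `dim R ⧸ 𝔮 ≤ n` for the minimal primes `𝔮` of `I`).

## References

* T. A. Springer, *Linear Algebraic Groups*, 2nd ed., Birkhäuser (1998), Thm 5.1.6 (ii).
* D. Mumford, *The Red Book of Varieties and Schemes*, LNM 1358, I §8, Thms 2–3.
* M. Bays, J. Kirby, *Pseudo-exponential maps, variants, and quasiminimality*, Algebra & Number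
  Theory 12 (2018) 493–549, Prop. 11.5 (proof).
-/

noncomputable section

open Set MvPolynomial

universe u

namespace Literature.NumberTheory.Transcendental

/-! ### Krull dimension of a quotient from its minimal primes -/

section MinimalPrimes

/-- **`dim R ⧸ I ≤ n` as soon as `dim R ⧸ 𝔮 ≤ n` for every minimal prime `𝔮` of `I`**: a chain
of primes above `I` starts above a minimal prime of `I`. [folklore] -/
theorem ringKrullDim_quotient_le_of_minimalPrimes {R : Type*} [CommRing R] (I : Ideal R) (n : ℕ)
    (h : ∀ 𝔮 ∈ I.minimalPrimes, ringKrullDim (R ⧸ 𝔮) ≤ n) : ringKrullDim (R ⧸ I) ≤ n := by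
  rw [ringKrullDim_quotient]
  refine iSup_le fun l => ?_
  -- the chain `l` lies above a minimal prime `𝔮` of `I`
  have h0 : I ≤ (l 0).1.asIdeal := (l 0).2
  obtain ⟨𝔮, h𝔮, h𝔮le⟩ := Ideal.exists_minimalPrimes_le h0
  have hmem : ∀ i, (l i).1 ∈ PrimeSpectrum.zeroLocus (𝔮 : Set R) := by
    intro i
    have hmono : (l 0).1 ≤ (l i).1 := l.monotone (Fin.zero_le _)
    intro x hx
    exact hmono (h𝔮le hx)
  let l' : LTSeries (PrimeSpectrum.zeroLocus (𝔮 : Set R)) :=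
    ⟨l.length, fun i => ⟨(l i).1, hmem i⟩, fun i => l.step i⟩
  have h1 : (l'.length : WithBot ℕ∞) ≤ Order.krullDim (PrimeSpectrum.zeroLocus (𝔮 : Set R)) :=
    Order.LTSeries.length_le_krullDim l'
  rw [← ringKrullDim_quotient] at h1
  exact h1.trans (h 𝔮 h𝔮)

end MinimalPrimes

/-! ### The coordinate ring `k[W ∩ Gᴺ]` of the torus part of `W = Z(P)` and the map `[M]` -/

namespace MonomialFibre

variable {k : Type u} [Field k] {N : ℕ} (P : Ideal (MvPolynomial (Fin N ⊕ Fin N) k))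

/-- The coordinate classes `x̄ⱼ, ȳⱼ ∈ k[W] = k[X, Y] ⧸ P`. [folklore] -/
def coord (j : Fin N ⊕ Fin N) : zeroLocusCoordRing P := Ideal.Quotient.mk P (X j)

/-- `ȳ = ∏ ȳᵢ ∈ k[W]`. [folklore] -/
def prodY : zeroLocusCoordRing P := ∏ i, coord P (Sum.inr i)

/-- `ȳ` is the class of `∏ Yᵢ`. [folklore] -/
theorem prodY_eq : prodY P = Ideal.Quotient.mk P (∏ i, X (Sum.inr i)) := by
  simp only [prodY, coord, map_prod]

/-- `ȳ ≠ 0` in `k[W]` when no `Yᵢ` lies in the prime `P`. [folklore] -/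
theorem prodY_ne_zero [P.IsPrime] (hY : ∀ i, (X (Sum.inr i) : MvPolynomial (Fin N ⊕ Fin N) k) ∉ P) :
    prodY P ≠ 0 := by
  rw [prodY_eq, Ne, Ideal.Quotient.eq_zero_iff_mem]
  intro h
  obtain ⟨i, -, hi⟩ := Ideal.IsPrime.prod_mem_iff.1 h
  exact hY i hi

/-- The coordinate ring `A = k[W ∩ Gᴺ] = k[W][1/ȳ]` of the torus part of `W = Z(P)`.
[folklore] -/
abbrev CoordG : Type u := Localization.Away (prodY P)

/-- The coordinate functions as elements of `A`. [folklore] -/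
def ξA (j : Fin N ⊕ Fin N) : CoordG P := algebraMap (zeroLocusCoordRing P) (CoordG P) (coord P j)

/-- The `ȳᵢ` are units of `A = k[W][1/ȳ]`. [folklore] -/
theorem isUnit_ξA_inr (i : Fin N) : IsUnit (ξA P (Sum.inr i)) :=
  IsLocalization.Away.isUnit_of_dvd (prodY P)
    (Finset.dvd_prod_of_mem (fun i => coord P (Sum.inr i)) (Finset.mem_univ i))

/-- The coordinates `θ = [M] ξ ∈ A` of the monomial map: linear forms in the `x̄ⱼ` and Laurent
monomials in the units `ȳⱼ`. [folklore] -/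
def θA (M : Matrix (Fin N) (Fin N) ℤ) : Fin N ⊕ Fin N → CoordG P :=
  Sum.elim (fun i => ∑ j, (M i j : CoordG P) * ξA P (Sum.inl j))
    (fun i => ∏ j, (((isUnit_ξA_inr P j).unit ^ (M i j) : (CoordG P)ˣ) : CoordG P))

/-- Ring homomorphisms into fields send powers of units to powers. [folklore] -/
theorem map_units_zpow {A C : Type*} [CommRing A] [Field C] (ψ : A →+* C) (u : Aˣ) (n : ℤ) :
    ψ ((u ^ n : Aˣ) : A) = (ψ (u : A)) ^ n :=
  calc ψ ((u ^ n : Aˣ) : A) = ((Units.map (ψ : A →* C) (u ^ n) : Cˣ) : C) :=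
        (Units.coe_map (ψ : A →* C) (u ^ n)).symm
    _ = (((Units.map (ψ : A →* C) u) ^ n : Cˣ) : C) := by rw [map_zpow]
    _ = ((Units.map (ψ : A →* C) u : Cˣ) : C) ^ n := Units.val_zpow_eq_zpow_val _ _
    _ = (ψ (u : A)) ^ n := by rw [Units.coe_map]; rfl

/-- Under any ring homomorphism into a field, `θ` becomes `[M]` of the image point. [folklore] -/
theorem map_θA {C : Type*} [Field C] (ψ : CoordG P →+* C) (M : Matrix (Fin N) (Fin N) ℤ) :
    ψ ∘ θA P M = matrixAct M (ψ ∘ ξA P) := by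
  funext j
  rcases j with i | i
  · simp only [θA, Function.comp_apply, Sum.elim_inl, matrixAct_inl, map_sum, map_mul,
      map_intCast]
  · simp only [θA, Function.comp_apply, Sum.elim_inr, matrixAct_inr, map_prod]
    refine Finset.prod_congr rfl fun j _ => ?_
    rw [map_units_zpow]
    rfl

/-- `aeval ξA = algebraMap ∘ mk`: polynomials evaluate on the coordinate classes through `k[W]`.
[folklore] -/
theorem aeval_ξA (g : MvPolynomial (Fin N ⊕ Fin N) k) :
    aeval (ξA P) g = algebraMap (zeroLocusCoordRing P) (CoordG P) (Ideal.Quotient.mk P g) := by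
  have : (aeval (ξA P) : MvPolynomial (Fin N ⊕ Fin N) k →ₐ[k] CoordG P) =
      (IsScalarTower.toAlgHom k (zeroLocusCoordRing P) (CoordG P)).comp (Ideal.Quotient.mkₐ k P) := by
    apply MvPolynomial.algHom_ext
    intro j
    simp only [aeval_X, AlgHom.coe_comp, Function.comp_apply, Ideal.Quotient.mkₐ_eq_mk,
      IsScalarTower.coe_toAlgHom']
    rfl
  rw [this]
  rfl

/-! ### Evaluation at points of `W ∩ Gᴺ` -/

variable {F : Type u} [Field F] [Algebra k F]

/-- Evaluation `k[W] → F` at a point `z ∈ W(F) = Z_F(P)`. [folklore] -/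
def ev₀ {z : Fin N ⊕ Fin N → F} (hz : z ∈ zeroLocus F P) : zeroLocusCoordRing P →ₐ[k] F :=
  Ideal.Quotient.liftₐ P (aeval z) fun a ha => (mem_zeroLocus_iff.1 hz) a ha

/-- `ev₀` on classes of polynomials is evaluation. [folklore] -/
theorem ev₀_mk {z : Fin N ⊕ Fin N → F} (hz : z ∈ zeroLocus F P) (g : MvPolynomial (Fin N ⊕ Fin N) k) :
    ev₀ P hz (Ideal.Quotient.mk P g) = aeval z g :=
  rfl

/-- `ev₀ (ȳ) = ∏ zᵢ`. [folklore] -/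
theorem ev₀_prodY {z : Fin N ⊕ Fin N → F} (hz : z ∈ zeroLocus F P) :
    ev₀ P hz (prodY P) = ∏ i, z (Sum.inr i) := by
  rw [prodY_eq, ev₀_mk, map_prod]
  simp only [aeval_X]

/-- **Evaluation `k[W ∩ Gᴺ] → F` at a torus point `z ∈ W(F) ∩ Gᴺ`** (the universal property of
the localisation: `ȳ(z) ≠ 0`). [folklore] -/
def ev {z : Fin N ⊕ Fin N → F} (hz : z ∈ zeroLocus F P) (hzT : z ∈ torusLocus F N) :
    CoordG P →ₐ[k] F :=
  IsLocalization.Away.liftAlgHom (prodY P) (f := ev₀ P hz)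
    (by
      rw [ev₀_prodY, isUnit_iff_ne_zero]
      exact Finset.prod_ne_zero_iff.2 fun i _ => hzT i)

/-- `ev` extends `ev₀`. [folklore] -/
theorem ev_algebraMap {z : Fin N ⊕ Fin N → F} (hz : z ∈ zeroLocus F P) (hzT : z ∈ torusLocus F N)
    (a : zeroLocusCoordRing P) :
    ev P hz hzT (algebraMap (zeroLocusCoordRing P) (CoordG P) a) = ev₀ P hz a := by
  change (IsLocalization.Away.liftAlgHom (prodY P) (f := ev₀ P hz) _).toRingHom _ = _
  rw [IsLocalization.Away.liftAlgHom_toRingHom]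
  exact IsLocalization.Away.lift_eq (prodY P) _ a

/-- `ev_z` of a coordinate function is the coordinate of `z`. [folklore] -/
theorem ev_ξA {z : Fin N ⊕ Fin N → F} (hz : z ∈ zeroLocus F P) (hzT : z ∈ torusLocus F N)
    (j : Fin N ⊕ Fin N) : ev P hz hzT (ξA P j) = z j := by
  rw [ξA, ev_algebraMap, coord, ev₀_mk, aeval_X]

/-- `ev_z ∘ ξ = z`. [folklore] -/
theorem ev_comp_ξA {z : Fin N ⊕ Fin N → F} (hz : z ∈ zeroLocus F P) (hzT : z ∈ torusLocus F N) :
    (ev P hz hzT : CoordG P → F) ∘ ξA P = z :=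
  funext (ev_ξA P hz hzT)

/-- `ev_z (θ) = [M] z`. [folklore] -/
theorem ev_θA {z : Fin N ⊕ Fin N → F} (hz : z ∈ zeroLocus F P) (hzT : z ∈ torusLocus F N)
    (M : Matrix (Fin N) (Fin N) ℤ) (j : Fin N ⊕ Fin N) :
    ev P hz hzT (θA P M j) = matrixAct M z j := by
  have h := congrFun (map_θA P (ev P hz hzT : CoordG P →+* F) M) j
  simp only [Function.comp_apply, RingHom.coe_coe] at h
  rw [h]
  congr 1
  exact ev_comp_ξA P hz hzT

/-- `ev_z (g(ξ)) = g(z)`. [folklore] -/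
theorem ev_aeval_ξA {z : Fin N ⊕ Fin N → F} (hz : z ∈ zeroLocus F P) (hzT : z ∈ torusLocus F N)
    (g : MvPolynomial (Fin N ⊕ Fin N) k) : ev P hz hzT (aeval (ξA P) g) = aeval z g := by
  rw [← AlgHom.comp_apply, MvPolynomial.comp_aeval]
  congr 1
  exact congrArg aeval (ev_comp_ξA P hz hzT)

/-- `ev_z (h(θ)) = h([M] z)`. [folklore] -/
theorem ev_aeval_θA {z : Fin N ⊕ Fin N → F} (hz : z ∈ zeroLocus F P) (hzT : z ∈ torusLocus F N)
    (M : Matrix (Fin N) (Fin N) ℤ) (h : MvPolynomial (Fin N ⊕ Fin N) k) :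
    ev P hz hzT (aeval (θA P M) h) = aeval (matrixAct M z) h := by
  rw [← AlgHom.comp_apply, MvPolynomial.comp_aeval]
  congr 1
  exact congrArg aeval (funext (ev_θA P hz hzT M))

/-! ### The subalgebra `B = k[θ] ⊆ A` of the monomial map and the fibre dimension theorem -/

/-- The `k`-subalgebra `B = k[θ] = k[[M] ξ] ⊆ A = k[W ∩ Gᴺ]`: the coordinate ring of the closure
of `[M](W ∩ Gᴺ)`, embedded by pull-back along `[M]`. [folklore] -/
def thetaAlg (M : Matrix (Fin N) (Fin N) ℤ) : Subalgebra k (CoordG P) :=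
  (aeval (θA P M) : MvPolynomial (Fin N ⊕ Fin N) k →ₐ[k] CoordG P).range

/-- Elements of `B = k[θ]` are the values `h(θ)` of polynomials over `k`. [folklore] -/
theorem mem_thetaAlg_iff (M : Matrix (Fin N) (Fin N) ℤ) {b : CoordG P} :
    b ∈ thetaAlg P M ↔ ∃ h : MvPolynomial (Fin N ⊕ Fin N) k, aeval (θA P M) h = b :=
  AlgHom.mem_range _

/-- `B = k[θ]` is a finitely generated `k`-algebra. [folklore] -/
instance finiteType_thetaAlg (M : Matrix (Fin N) (Fin N) ℤ) : Algebra.FiniteType k (thetaAlg P M) :=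
  Algebra.FiniteType.of_surjective (aeval (θA P M)).rangeRestrict
    (AlgHom.rangeRestrict_surjective _)

/-- `B ⊆ A` acts faithfully on `A`. [folklore] -/
instance faithfulSMul_thetaAlg (M : Matrix (Fin N) (Fin N) ℤ) :
    FaithfulSMul (thetaAlg P M) (CoordG P) :=
  (faithfulSMul_iff_algebraMap_injective _ _).2 Subtype.val_injective

/-- `A = k[W ∩ Gᴺ]` is a finitely generated `k`-algebra. [folklore] -/
theorem finiteType_coordG [P.IsPrime] : Algebra.FiniteType k (CoordG P) :=
  Algebra.FiniteType.trans (S := zeroLocusCoordRing P) inferInstance inferInstance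

/-- **On `B`, evaluation at `z` only depends on `[M] z`**: two torus points of `W` with the same
image under `[M]` induce the same homomorphism `B → F`. [folklore] -/
theorem ev_eq_of_matrixAct_eq {z w : Fin N ⊕ Fin N → F} (hz : z ∈ zeroLocus F P)
    (hzT : z ∈ torusLocus F N) (hw : w ∈ zeroLocus F P) (hwT : w ∈ torusLocus F N)
    (M : Matrix (Fin N) (Fin N) ℤ) (hM : matrixAct M w = matrixAct M z) {b : CoordG P}
    (hb : b ∈ thetaAlg P M) : ev P hw hwT b = ev P hz hzT b := by
  obtain ⟨h, rfl⟩ := (mem_thetaAlg_iff P M).1 hb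
  rw [ev_aeval_θA, ev_aeval_θA, hM]

/-! ### Evaluation of `B` at a `k`-rational value of `[M]` -/

section Rational

variable {P} [P.IsPrime] {z : Fin N ⊕ Fin N → F} (hz : z ∈ zeroLocus F P) (hzT : z ∈ torusLocus F N)
  (M : Matrix (Fin N) (Fin N) ℤ) (hrat : ∀ j, matrixAct M z j ∈ Set.range (algebraMap k F))

omit [P.IsPrime] in
include hrat in
/-- If `[M] z` is `k`-rational, `ev_z` maps `B = k[θ]` into `k ⊆ F`. [folklore] -/
theorem ev_mem_range_of_mem_thetaAlg {b : CoordG P} (hb : b ∈ thetaAlg P M) :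
    ev P hz hzT b ∈ (Algebra.ofId k F).range := by
  obtain ⟨h, rfl⟩ := (mem_thetaAlg_iff P M).1 hb
  rw [ev_aeval_θA]
  choose y' hy' using hrat
  have hy : matrixAct M z = fun j => algebraMap k F (y' j) := funext fun j => (hy' j).symm
  rw [hy]
  refine ⟨aeval y' h, ?_⟩
  change algebraMap k F (aeval y' h) = aeval (algebraMap k F ∘ y') h
  exact (MvPolynomial.aeval_algebraMap_apply F y' h).symm

/-- **Evaluation `B → k` at the `k`-rational value `y = [M] z`.** [folklore] -/
def evB : thetaAlg P M →ₐ[k] k :=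
  ((AlgEquiv.ofInjectiveField (Algebra.ofId k F)).symm : (Algebra.ofId k F).range →ₐ[k] k).comp
    (((ev P hz hzT).comp (thetaAlg P M).val).codRestrict (Algebra.ofId k F).range
      fun b => ev_mem_range_of_mem_thetaAlg hz hzT M hrat b.2)

omit [P.IsPrime] in
/-- `evB` is `ev_z` restricted to `B`, read in `k`. [folklore] -/
theorem algebraMap_evB (b : thetaAlg P M) :
    algebraMap k F (evB hz hzT M hrat b) = ev P hz hzT (b : CoordG P) := by
  set e := AlgEquiv.ofInjectiveField (Algebra.ofId k F) with he
  set c : (Algebra.ofId k F).range :=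
    (((ev P hz hzT).comp (thetaAlg P M).val).codRestrict (Algebra.ofId k F).range
      fun b => ev_mem_range_of_mem_thetaAlg hz hzT M hrat b.2) b with hc
  have h1 : evB hz hzT M hrat b = e.symm c := rfl
  have h2 : (c : F) = ev P hz hzT (b : CoordG P) := rfl
  rw [h1, ← h2]
  conv_rhs => rw [← e.apply_symm_apply c]
  rw [he]
  exact (AlgEquiv.ofInjective_apply (Algebra.ofId k F) _ _).symm

omit [P.IsPrime] in
/-- `evB` is onto `k` (it fixes the constants). [folklore] -/
theorem evB_surjective : Function.Surjective (evB hz hzT M hrat) := fun c =>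
  ⟨algebraMap k (thetaAlg P M) c, AlgHom.commutes _ c⟩

/-- The maximal ideal `m_y ⊆ B` of the `k`-rational value `y = [M] z`. [folklore] -/
def maxIdeal : Ideal (thetaAlg P M) := RingHom.ker (evB hz hzT M hrat)

omit [P.IsPrime] in
/-- `m_y` is a maximal ideal of `B`. [folklore] -/
theorem isMaximal_maxIdeal : (maxIdeal hz hzT M hrat).IsMaximal :=
  RingHom.ker_isMaximal_of_surjective _ (evB_surjective hz hzT M hrat)

omit [P.IsPrime] in
/-- `h(θ) ∉ m_y` iff `h(y) ≠ 0`. [folklore] -/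
theorem mem_maxIdeal_iff (b : thetaAlg P M) :
    b ∈ maxIdeal hz hzT M hrat ↔ ev P hz hzT (b : CoordG P) = 0 := by
  rw [maxIdeal, RingHom.mem_ker, ← algebraMap_evB hz hzT M hrat b,
    map_eq_zero_iff _ (algebraMap k F).injective]

omit [P.IsPrime] in
/-- **Every torus point of `W` over `y` kills `m_y A`.** [folklore] -/
theorem ev_eq_zero_of_mem_map_maxIdeal {w : Fin N ⊕ Fin N → F} (hw : w ∈ zeroLocus F P)
    (hwT : w ∈ torusLocus F N) (hM : matrixAct M w = matrixAct M z) {b : CoordG P}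
    (hb : b ∈ (maxIdeal hz hzT M hrat).map (algebraMap (thetaAlg P M) (CoordG P))) :
    ev P hw hwT b = 0 := by
  refine Submodule.span_induction (p := fun b _ => ev P hw hwT b = 0) ?_ (by simp)
    (fun _ _ _ _ h h' => by rw [map_add, h, h', add_zero])
    (fun a _ _ h => by rw [smul_eq_mul, map_mul, h, mul_zero]) hb
  rintro _ ⟨b, hb, rfl⟩
  have hbB : (b : CoordG P) ∈ thetaAlg P M := b.2
  change ev P hw hwT (b : CoordG P) = 0
  rw [ev_eq_of_matrixAct_eq P hz hzT hw hwT M hM hbB]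
  exact (mem_maxIdeal_iff hz hzT M hrat b).1 hb

end Rational

/-! ### The fibre dimension theorem -/

section Main

variable {P} [P.IsPrime]

omit [P.IsPrime] in
/-- **Minimal primes of the contraction to `k[W]` of an ideal of `k[W ∩ Gᴺ]` avoid `ȳ`** (elements
of minimal primes are zero divisors modulo the ideal, and `ȳ` is a unit upstairs). [folklore] -/
theorem prodY_notMem_of_mem_minimalPrimes_comap {J : Ideal (CoordG P)}
    {𝔮 : Ideal (zeroLocusCoordRing P)}
    (h𝔮 : 𝔮 ∈ (J.comap (algebraMap (zeroLocusCoordRing P) (CoordG P))).minimalPrimes) :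
    prodY P ∉ 𝔮 := by
  intro hmem
  obtain ⟨c, hc, hyc⟩ := Ideal.exists_mul_mem_of_mem_minimalPrimes h𝔮 hmem
  apply hc
  rw [Ideal.mem_comap, map_mul] at hyc
  rw [Ideal.mem_comap]
  exact (Ideal.unit_mul_mem_iff_mem J (IsLocalization.Away.algebraMap_isUnit (prodY P))).1 hyc

omit [P.IsPrime] in
/-- **The extension to `k[W ∩ Gᴺ]` of a minimal prime of a contracted ideal is a minimal prime of
the ideal** (prime correspondence for localisations). [folklore] -/
theorem map_mem_minimalPrimes_of_mem_minimalPrimes_comap {J : Ideal (CoordG P)}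
    {𝔮 : Ideal (zeroLocusCoordRing P)}
    (h𝔮 : 𝔮 ∈ (J.comap (algebraMap (zeroLocusCoordRing P) (CoordG P))).minimalPrimes) :
    𝔮.map (algebraMap (zeroLocusCoordRing P) (CoordG P)) ∈ J.minimalPrimes := by
  haveI h𝔮p : 𝔮.IsPrime := h𝔮.1.1
  have hy : prodY P ∉ 𝔮 := prodY_notMem_of_mem_minimalPrimes_comap h𝔮
  have hdisj : Disjoint ((Submonoid.powers (prodY P) : Submonoid (zeroLocusCoordRing P)) :
      Set (zeroLocusCoordRing P)) (𝔮 : Set (zeroLocusCoordRing P)) := by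
    refine Set.disjoint_left.2 ?_
    rintro _ ⟨n, rfl⟩ hx
    exact hy (h𝔮p.mem_of_pow_mem n hx)
  have hQp : (𝔮.map (algebraMap (zeroLocusCoordRing P) (CoordG P))).IsPrime :=
    IsLocalization.isPrime_of_isPrime_disjoint (Submonoid.powers (prodY P)) (CoordG P) 𝔮 h𝔮p hdisj
  have hunder : (𝔮.map (algebraMap (zeroLocusCoordRing P) (CoordG P))).under
      (zeroLocusCoordRing P) = 𝔮 :=
    IsLocalization.under_map_of_isPrime_disjoint (Submonoid.powers (prodY P)) (CoordG P) h𝔮p hdisj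
  have hJ : J = (J.under (zeroLocusCoordRing P)).map (algebraMap _ (CoordG P)) :=
    (IsLocalization.map_under (Submonoid.powers (prodY P)) (CoordG P) J).symm
  refine ⟨⟨hQp, ?_⟩, ?_⟩
  · rw [hJ]
    exact Ideal.map_mono h𝔮.1.2
  · rintro Q' ⟨hQ'p, hJQ'⟩ hQ'Q
    have h1 : J.under (zeroLocusCoordRing P) ≤ Q'.under (zeroLocusCoordRing P) :=
      Ideal.comap_mono hJQ'
    have h2 : Q'.under (zeroLocusCoordRing P) ≤ 𝔮 := by
      rw [← hunder]; exact Ideal.comap_mono hQ'Q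
    haveI : (Q'.under (zeroLocusCoordRing P)).IsPrime := Ideal.IsPrime.comap _
    have h3 : 𝔮 ≤ Q'.under (zeroLocusCoordRing P) := h𝔮.2 ⟨inferInstance, h1⟩ h2
    calc 𝔮.map (algebraMap (zeroLocusCoordRing P) (CoordG P))
        ≤ (Q'.under (zeroLocusCoordRing P)).map (algebraMap _ (CoordG P)) := Ideal.map_mono h3
      _ = Q' := IsLocalization.map_under (Submonoid.powers (prodY P)) (CoordG P) Q'

omit [P.IsPrime] in
/-- **`dim k[W] ⧸ 𝔮 = dim k[W ∩ Gᴺ] ⧸ 𝔮 k[W ∩ Gᴺ]`** for a prime `𝔮 ∌ ȳ` of `k[W]`: the second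
ring is the localisation of the affine domain `k[W] ⧸ 𝔮` away from `ȳ ≠ 0`. [folklore] -/
theorem ringKrullDim_quotient_map_eq {𝔮 : Ideal (zeroLocusCoordRing P)} [𝔮.IsPrime]
    (hy : prodY P ∉ 𝔮) :
    ringKrullDim (CoordG P ⧸ 𝔮.map (algebraMap (zeroLocusCoordRing P) (CoordG P))) =
      ringKrullDim (zeroLocusCoordRing P ⧸ 𝔮) := by
  have hinst : IsLocalization (R := zeroLocusCoordRing P ⧸ 𝔮)
      (Algebra.algebraMapSubmonoid (R := zeroLocusCoordRing P) (zeroLocusCoordRing P ⧸ 𝔮)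
        (Submonoid.powers (prodY P)))
      (CoordG P ⧸ 𝔮.map (algebraMap (zeroLocusCoordRing P) (CoordG P))) := inferInstance
  rw [Algebra.algebraMapSubmonoid_powers, Ideal.Quotient.algebraMap_eq] at hinst
  haveI : IsLocalization.Away (Ideal.Quotient.mk 𝔮 (prodY P))
      (CoordG P ⧸ 𝔮.map (algebraMap (zeroLocusCoordRing P) (CoordG P))) := hinst
  -- compare with the standard localisation of `k[W] ⧸ 𝔮` away from `ȳ`
  have e : (CoordG P ⧸ 𝔮.map (algebraMap (zeroLocusCoordRing P) (CoordG P))) ≃+*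
      Localization.Away (Ideal.Quotient.mk 𝔮 (prodY P)) :=
    (IsLocalization.algEquiv (Submonoid.powers (Ideal.Quotient.mk 𝔮 (prodY P)))
      (CoordG P ⧸ 𝔮.map (algebraMap (zeroLocusCoordRing P) (CoordG P)))
      (Localization.Away (Ideal.Quotient.mk 𝔮 (prodY P)))).toRingEquiv
  have hx : Ideal.Quotient.mk 𝔮 (prodY P) ≠ 0 := by
    rwa [Ne, Ideal.Quotient.eq_zero_iff_mem]
  rw [ringKrullDim_eq_of_ringEquiv e]
  exact Literature.RingTheory.KrullDimension.ringKrullDim_away_eq k (D := zeroLocusCoordRing P ⧸ 𝔮)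
    hx (Localization.Away (Ideal.Quotient.mk 𝔮 (prodY P)))

/-- `k[W ∩ Gᴺ]` is a domain when `ȳ ≠ 0` in the domain `k[W]`. [folklore] -/
theorem isDomain_coordG (hY : ∀ i, (X (Sum.inr i) : MvPolynomial (Fin N ⊕ Fin N) k) ∉ P) :
    IsDomain (CoordG P) :=
  IsLocalization.isDomain_localization
    (powers_le_nonZeroDivisors_of_noZeroDivisors (prodY_ne_zero P hY))

omit [P.IsPrime] in
/-- **`dim k[W ∩ Gᴺ] ⧸ m_y k[W ∩ Gᴺ]` bounds the dimension over `F` of the fibre of `[M]` over the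
`k`-rational value `y`**: the `k`-closure of the fibre `{w ∈ W ∩ Gᴺ | [M] w = [M] z}` is cut out by
an ideal containing the contraction of `m_y A` to `k[X, Y]`. [folklore] -/
theorem zariskiDim_fibre_le {z : Fin N ⊕ Fin N → F} (hz : z ∈ zeroLocus F P)
    (hzT : z ∈ torusLocus F N) (M : Matrix (Fin N) (Fin N) ℤ)
    (hrat : ∀ j, matrixAct M z j ∈ Set.range (algebraMap k F)) :
    zariskiDim F {w | w ∈ zeroLocus F P ∩ torusLocus F N ∧ matrixAct M w = matrixAct M z} ≤
      ringKrullDim (zeroLocusCoordRing P ⧸ ((maxIdeal hz hzT M hrat).map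
        (algebraMap (thetaAlg P M) (CoordG P))).comap
          (algebraMap (zeroLocusCoordRing P) (CoordG P))) := by
  set Φ : Set (Fin N ⊕ Fin N → F) :=
    {w | w ∈ zeroLocus F P ∩ torusLocus F N ∧ matrixAct M w = matrixAct M z} with hΦ
  set mA : Ideal (CoordG P) := (maxIdeal hz hzT M hrat).map (algebraMap (thetaAlg P M) (CoordG P))
    with hmA
  set 𝔞 : Ideal (zeroLocusCoordRing P) := mA.comap (algebraMap (zeroLocusCoordRing P) (CoordG P))
    with h𝔞
  -- polynomials whose class lies in `𝔞` vanish on `Φ`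
  have hvan : ∀ g : MvPolynomial (Fin N ⊕ Fin N) k, Ideal.Quotient.mk P g ∈ 𝔞 →
      g ∈ vanishingIdeal k Φ := by
    intro g hg w hw
    obtain ⟨⟨hw, hwT⟩, hMw⟩ := hw
    rw [← ev_aeval_ξA P hw hwT g, aeval_ξA]
    exact ev_eq_zero_of_mem_map_maxIdeal hz hzT M hrat hw hwT hMw (Ideal.mem_comap.1 hg)
  -- `P ⊆ I_k(Φ)`
  have hPΦ : ∀ g ∈ P, g ∈ vanishingIdeal k Φ := by
    intro g hg w hw
    exact (mem_zeroLocus_iff.1 hw.1.1) g hg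
  -- the surjection `k[W] ⧸ 𝔞 → k[X] ⧸ I_k(Φ)`
  let g₁ : zeroLocusCoordRing P →+* MvPolynomial (Fin N ⊕ Fin N) k ⧸ vanishingIdeal k Φ :=
    Ideal.Quotient.lift P (Ideal.Quotient.mk (vanishingIdeal k Φ)) fun g hg =>
      Ideal.Quotient.eq_zero_iff_mem.2 (hPΦ g hg)
  have hg₁ : ∀ a ∈ 𝔞, g₁ a = 0 := by
    intro a ha
    obtain ⟨g, rfl⟩ := Ideal.Quotient.mk_surjective a
    change Ideal.Quotient.mk (vanishingIdeal k Φ) g = 0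
    exact Ideal.Quotient.eq_zero_iff_mem.2 (hvan g ha)
  let g₂ : zeroLocusCoordRing P ⧸ 𝔞 →+* MvPolynomial (Fin N ⊕ Fin N) k ⧸ vanishingIdeal k Φ :=
    Ideal.Quotient.lift 𝔞 g₁ hg₁
  have hg₂ : Function.Surjective g₂ := by
    intro x
    obtain ⟨g, rfl⟩ := Ideal.Quotient.mk_surjective x
    exact ⟨Ideal.Quotient.mk 𝔞 (Ideal.Quotient.mk P g), rfl⟩
  calc zariskiDim F Φ ≤ ringKrullDim (MvPolynomial (Fin N ⊕ Fin N) k ⧸ vanishingIdeal k Φ) :=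
        Literature.RingTheory.KrullDimension.ringKrullDim_quotient_vanishingIdeal_le (k := k) Φ
    _ ≤ ringKrullDim (zeroLocusCoordRing P ⧸ 𝔞) := ringKrullDim_le_of_surjective g₂ hg₂

omit [P.IsPrime] in
/-- **The closure of `[M](W ∩ Gᴺ)` has dimension at most `dim B`**: its `k`-ideal contains the
kernel of `h ↦ h(θ)`. [folklore] -/
theorem zariskiDim_image_matrixAct_le_ringKrullDim_thetaAlg (M : Matrix (Fin N) (Fin N) ℤ) :
    zariskiDim F (matrixAct M '' (zeroLocus F P ∩ torusLocus F N)) ≤ ringKrullDim (thetaAlg P M) := by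
  set Im : Set (Fin N ⊕ Fin N → F) := matrixAct M '' (zeroLocus F P ∩ torusLocus F N) with hIm
  set φ : MvPolynomial (Fin N ⊕ Fin N) k →ₐ[k] CoordG P := aeval (θA P M) with hφ
  have hker : ∀ g ∈ RingHom.ker φ, g ∈ vanishingIdeal k Im := by
    intro g hg
    rw [RingHom.mem_ker] at hg
    rw [mem_vanishingIdeal_iff]
    rintro _ ⟨w, ⟨hw, hwT⟩, rfl⟩
    rw [← ev_aeval_θA P hw hwT M g]
    change ev P hw hwT (φ g) = 0
    rw [hg, map_zero]
  -- `k[X] ⧸ ker φ ≃ B`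
  have e : (MvPolynomial (Fin N ⊕ Fin N) k ⧸ RingHom.ker φ) ≃ₐ[k] thetaAlg P M :=
    (Ideal.quotientEquivAlgOfEq k (AlgHom.ker_rangeRestrict φ).symm).trans
      (Ideal.quotientKerAlgEquivOfSurjective (AlgHom.rangeRestrict_surjective φ))
  calc zariskiDim F Im ≤ ringKrullDim (MvPolynomial (Fin N ⊕ Fin N) k ⧸ vanishingIdeal k Im) :=
        Literature.RingTheory.KrullDimension.ringKrullDim_quotient_vanishingIdeal_le (k := k) Im
    _ ≤ ringKrullDim (MvPolynomial (Fin N ⊕ Fin N) k ⧸ RingHom.ker φ) :=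
        ringKrullDim_le_of_surjective (Ideal.Quotient.factor fun g hg => hker g hg)
          (Ideal.Quotient.factor_surjective _)
    _ = ringKrullDim (thetaAlg P M) := ringKrullDim_eq_of_ringEquiv e.toRingEquiv

variable [IsAlgClosed F]

/-- **A non-zero element `h(θ)` of `B` gives a torus point of `W` with `h([M] w) ≠ 0`** (`F`
algebraically closed): otherwise, clearing denominators, `h ∘ [M]` times a monomial is a
polynomial over `k` vanishing on `W ∩ Gᴺ`, hence in `P` (through a component of `W_F`), hence
zero in `k[W ∩ Gᴺ]`. [folklore] -/
theorem exists_aeval_matrixAct_ne_zero (hY : ∀ i, (X (Sum.inr i) : MvPolynomial (Fin N ⊕ Fin N) k) ∉ P)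
    (M : Matrix (Fin N) (Fin N) ℤ) {h : MvPolynomial (Fin N ⊕ Fin N) k} (hh : aeval (θA P M) h ≠ 0) :
    ∃ w ∈ zeroLocus F P ∩ torusLocus F N, aeval (matrixAct M w) h ≠ 0 := by
  classical
  haveI := isDomain_coordG hY
  by_contra hall
  push Not at hall
  apply hh
  obtain ⟨N', a, hNa⟩ := exists_mul_prod_pow_eq_aeval M h
  -- `a ∈ P`, through a component `Z(Q)` of `W_F`
  obtain ⟨Q, hQ⟩ := LocusComponents.exists_mem_minimalPrimes_map (k := k) (F := F) (P := P)
  haveI : Q.IsPrime := hQ.1.1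
  have haQ : MvPolynomial.map (algebraMap k F) a ∈
      vanishingIdeal F (zeroLocus F Q ∩ torusLocus F N) := by
    rw [mem_vanishingIdeal_iff]
    rintro w ⟨hwQ, hwT⟩
    have hw : w ∈ zeroLocus F P := LocusComponents.zeroLocus_subset_zeroLocus hQ hwQ
    rw [aeval_map_algebraMap, ← hNa w hwT, hall w ⟨hw, hwT⟩, zero_mul]
  rw [vanishingIdeal_zeroLocus_inter_torusLocus Q
    (LocusComponents.component_inter_torusLocus_nonempty hQ hY)] at haQ
  have haP : a ∈ P := by
    rw [← LocusComponents.under_eq_of_mem_minimalPrimes_map hQ, Ideal.under_def, Ideal.mem_comap,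
      MvPolynomial.algebraMap_def]
    exact haQ
  -- read the identity in the fraction field of `A`
  set E := FractionRing (CoordG P) with hE
  let ι : CoordG P →ₐ[k] E := IsScalarTower.toAlgHom k (CoordG P) E
  have hι : Function.Injective ι := IsFractionRing.injective (CoordG P) E
  set z₀ : Fin N ⊕ Fin N → E := ι ∘ ξA P with hz₀
  have hz₀T : z₀ ∈ torusLocus E N := fun i =>
    ((isUnit_ξA_inr P i).map ι).ne_zero
  have h1 : aeval z₀ a = 0 := by
    rw [hz₀, show (ι : CoordG P → E) ∘ ξA P = fun j => ι (ξA P j) from rfl, ← MvPolynomial.comp_aeval,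
      AlgHom.comp_apply, aeval_ξA, Ideal.Quotient.eq_zero_iff_mem.2 haP, map_zero, map_zero]
  have h2 : aeval (matrixAct M z₀) h = ι (aeval (θA P M) h) := by
    rw [hz₀, show (ι : CoordG P → E) = ((ι : CoordG P →+* E) : CoordG P → E) from rfl, ← map_θA P (ι : CoordG P →+* E) M]
    rw [show ((ι : CoordG P →+* E) : CoordG P → E) ∘ θA P M = fun j => ι (θA P M j) from rfl,
      ← MvPolynomial.comp_aeval, AlgHom.comp_apply]
    rfl
  have h3 := hNa z₀ hz₀T
  rw [h1, h2] at h3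
  have h4 : ι (aeval (θA P M) h) = 0 :=
    (mul_eq_zero.1 h3).resolve_right (pow_ne_zero _ (Finset.prod_ne_zero_iff.2 fun i _ => hz₀T i))
  exact hι (by rw [h4, map_zero])

/-- **The fibre dimension theorem for `[M]` on `W ∩ Gᴺ` at `k`-rational values** (the dimension of
the generic fibres, Springer *LAG* 5.1.6 (ii) / Mumford *Red Book* I.8 Thm 3, for the dominant
morphism `[M] : W ∩ Gᴺ → \overline{[M](W ∩ Gᴺ)}` of `k`-varieties, read at `F`-points): for a prime
`P ⊆ k[X, Y]` with `W = Z_F(P)` meeting the torus and an integer matrix `M`, there is a polynomial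
`h` over `k`, not vanishing identically on `[M](W ∩ Gᴺ)`, such that for every torus point `z` of
`W` whose image `y = [M] z` is `k`-rational with `h(y) ≠ 0`,
`dim_F {w ∈ W ∩ Gᴺ | [M] w = y} + dim_F [M](W ∩ Gᴺ) ≤ dim_k W`.
[cite: SpringerLAG1998, 5.1.6 (ii)] -/
theorem exists_fibre_dimension_bound (hY : ∀ i, (X (Sum.inr i) : MvPolynomial (Fin N ⊕ Fin N) k) ∉ P)
    (M : Matrix (Fin N) (Fin N) ℤ) :
    ∃ h : MvPolynomial (Fin N ⊕ Fin N) k,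
      (∃ w ∈ zeroLocus F P ∩ torusLocus F N, aeval (matrixAct M w) h ≠ 0) ∧
      ∀ z ∈ zeroLocus F P ∩ torusLocus F N, (∀ j, matrixAct M z j ∈ Set.range (algebraMap k F)) →
        aeval (matrixAct M z) h ≠ 0 →
        zariskiDim F {w | w ∈ zeroLocus F P ∩ torusLocus F N ∧ matrixAct M w = matrixAct M z} +
            zariskiDim F (matrixAct M '' (zeroLocus F P ∩ torusLocus F N)) ≤
          ringKrullDim (zeroLocusCoordRing P) := by
  classical
  haveI := isDomain_coordG hY
  haveI : Algebra.FiniteType k (CoordG P) := finiteType_coordG P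
  obtain ⟨f, e, r, hf0, hdimB, hdimA, hfib⟩ :=
    Literature.RingTheory.KrullDimension.exists_ringKrullDim_quotient_eq_of_mem_minimalPrimes k
      (A := thetaAlg P M) (B := CoordG P)
  obtain ⟨h, hh⟩ := (mem_thetaAlg_iff P M).1 f.2
  have hh0 : aeval (θA P M) h ≠ 0 := by
    rw [hh]
    exact fun h0 => hf0 (Subtype.ext h0)
  refine ⟨h, exists_aeval_matrixAct_ne_zero hY M hh0, ?_⟩
  rintro z ⟨hz, hzT⟩ hrat hhz
  -- the maximal ideal `m` of the rational value, `f ∉ m`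
  have hfm : f ∉ maxIdeal hz hzT M hrat := by
    rw [mem_maxIdeal_iff, ← hh, ev_aeval_θA]
    exact hhz
  have hfibz := hfib (maxIdeal hz hzT M hrat) (isMaximal_maxIdeal hz hzT M hrat) hfm
  set mA : Ideal (CoordG P) := (maxIdeal hz hzT M hrat).map (algebraMap (thetaAlg P M) (CoordG P))
    with hmA
  set 𝔞 : Ideal (zeroLocusCoordRing P) := mA.comap (algebraMap (zeroLocusCoordRing P) (CoordG P))
    with h𝔞
  -- `dim k[W] ⧸ 𝔞 ≤ r`
  have h𝔞dim : ringKrullDim (zeroLocusCoordRing P ⧸ 𝔞) ≤ r := by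
    refine ringKrullDim_quotient_le_of_minimalPrimes 𝔞 r fun 𝔮 h𝔮 => ?_
    haveI : 𝔮.IsPrime := h𝔮.1.1
    have hy : prodY P ∉ 𝔮 := prodY_notMem_of_mem_minimalPrimes_comap h𝔮
    rw [← ringKrullDim_quotient_map_eq (k := k) hy]
    exact (hfibz _ (map_mem_minimalPrimes_of_mem_minimalPrimes_comap h𝔮)).le
  have hΦ := (zariskiDim_fibre_le (F := F) hz hzT M hrat).trans h𝔞dim
  have hIm := zariskiDim_image_matrixAct_le_ringKrullDim_thetaAlg (P := P) (F := F) M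
  rw [hdimB] at hIm
  -- `dim k[W] = dim A = e + r`
  have hA : ringKrullDim (CoordG P) = ringKrullDim (zeroLocusCoordRing P) :=
    Literature.RingTheory.KrullDimension.ringKrullDim_away_eq k (D := zeroLocusCoordRing P)
      (prodY_ne_zero P hY) (CoordG P)
  rw [← hA, hdimA]
  calc zariskiDim F {w | w ∈ zeroLocus F P ∩ torusLocus F N ∧ matrixAct M w = matrixAct M z} +
        zariskiDim F (matrixAct M '' (zeroLocus F P ∩ torusLocus F N))
      ≤ (r : WithBot ℕ∞) + (e : WithBot ℕ∞) := add_le_add hΦ hIm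
    _ = ((e + r : ℕ) : WithBot ℕ∞) := by push_cast; ring

end Main

end MonomialFibre

end Literature.NumberTheory.Transcendental
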